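import Mathlib
import Summits.QuantumAdvantage.QuantumAdvantage.Theorems.MobiusLadderQuadraticDigitPhasesStubOneCutKataiCS

/-!
# `QuadraticDigitPhases` (stmt-QuantumAdvantage-1391), line `Sketch` — lemmas for the refutation stub `stub_uwcOpCoreFalse`

The v24–v29 core of the line (`stub_uwcOpCore`: "cut rank `< R₀` and `g` sequential far pairs force the
`ℓ¹` mass of every family obeying the one-step transfer recursion below `δ 2^N`") is FALSE.  This file
is the pattern-generic part of the counterexample, for the INTERLEAVED PRODUCT PATTERN
`a i j = 1 ⟺ (i ∈ BF ∧ j ∈ KF) ∨ (i ∈ KF ∧ j ∈ BF)` (pair coefficients of `(Σ_{i ∈ BF} xᵢ)(Σ_{j ∈ KF} xⱼ)`)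
with two storing columns `N ∈ BF`, `N + 1 ∈ KF`, `BF ∩ KF = ∅`, and no linear terms (`l = 0`):

* `step_inv`, `step_mass`: an ABSTRACT SIGNED TRANSFER STEP — if the old family is `σ · |old|` and
  supported on valid states, the step sign is compatible with `σ` (`sg · σ = σ' ∘ F` on valid states) and
  validity is preserved by the transition `F`, then the new family is `σ' · |new|`, supported on valid
  states, and the unsigned masses are transferred exactly (total mass × branching factor);
* `stepRHS_eq`: the verbatim right-hand side of the registered recursion IS such a transfer over the
  state space `(range p × range q) × labels²` (transition `F`, step sign `sg` given by `hF`, `hsg`);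
* `Zadd_VL`, `sign_compat`: under the product pattern the reachable labels are CANONICAL (`V M α β`:
  value `α` on the `k`-columns `≥ M`, `β` on the `b`-columns `≥ M`, zero elsewhere); a `b`-row adds its
  digit to `α`, a `k`-row to `β`, and the step sign `(-1)^{y·π(M)}` is exactly the change of
  `(-1)^{αβ} = (-1)^{π(N+1)π(N)}` — the phase is a function of the STORED end label, so there is NO
  CANCELLATION AT ALL: `inv_mass`, `stub_uwcFalseMass` give `Σ |μ N| = 2^N` for every family `μ` obeying the
  recursion from the point mass.

Everything is stated without auxiliary definitions (functions with defining hypotheses `ha`, `hV`, `hF`,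
`hsg`, as in `…StubOpSem`).  The concrete positions, the cut-rank bound, the far pairs and the loss count
are in the main file `…StubUwcOpCoreFalse`.
-/

set_option linter.dupNamespace false -- D-0017: single-problem summit ⇒ `QuantumAdvantage.QuantumAdvantage` by design

namespace Summit.QuantumAdvantage.QuantumAdvantage.Theorems.MobiusLadderQuadraticDigitPhasesStubUwcOpCoreFalseLemmas

open Finset
open Summit.QuantumAdvantage.QuantumAdvantage.Theorems.MobiusLadderQuadraticDigitPhasesStubOneCutKatai
  (sign_add abs_sign)

variable {n : ℕ} (BF KF : Finset ℕ) (a : ℕ → ℕ → ZMod 2) (V : ℕ → ZMod 2 → ZMod 2 → (Fin n → ZMod 2))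

/-- Values of the canonical label on the columns `≥ M`. -/
theorem ev_VL (hV : ∀ M α β, V M α β = fun j : Fin n => if M ≤ (j : ℕ) then (if (j : ℕ) ∈ KF then α else if (j : ℕ) ∈ BF then β else 0) else 0) {M j : ℕ} (hj : j < n) (hMj : M ≤ j)
    (α β : ZMod 2) : (if h : j < n then V M α β ⟨j, h⟩ else 0) = if j ∈ KF then α else if j ∈ BF then β else 0 := by
  rw [dif_pos hj, hV]
  simp only [if_pos hMj]

/-- The canonical label carries `α` at a `k`-column `≥ M`. -/
theorem ev_VL_K (hV : ∀ M α β, V M α β = fun j : Fin n => if M ≤ (j : ℕ) then (if (j : ℕ) ∈ KF then α else if (j : ℕ) ∈ BF then β else 0) else 0) {M j : ℕ} (hj : j < n) (hMj : M ≤ j)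
    (hK : j ∈ KF) (α β : ZMod 2) : (if h : j < n then V M α β ⟨j, h⟩ else 0) = α := by
  rw [ev_VL BF KF V hV hj hMj, if_pos hK]

/-- The canonical label carries `β` at a `b`-column `≥ M`. -/
theorem ev_VL_B (hV : ∀ M α β, V M α β = fun j : Fin n => if M ≤ (j : ℕ) then (if (j : ℕ) ∈ KF then α else if (j : ℕ) ∈ BF then β else 0) else 0) {M j : ℕ} (hj : j < n) (hMj : M ≤ j)
    (hB : j ∈ BF) (hK : j ∉ KF) (α β : ZMod 2) : (if h : j < n then V M α β ⟨j, h⟩ else 0) = β := by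
  rw [ev_VL BF KF V hV hj hMj, if_neg hK, if_pos hB]

/-- The zero label is canonical. -/
theorem VL_zero_zero (hV : ∀ M α β, V M α β = fun j : Fin n => if M ≤ (j : ℕ) then (if (j : ℕ) ∈ KF then α else if (j : ℕ) ∈ BF then β else 0) else 0) (M : ℕ) : V M 0 0 = 0 := by
  rw [hV]
  funext j
  simp

/-- LABEL UPDATE of a canonical label under the product pattern: a `b`-row adds the new digit to the
`k`-value, a `k`-row adds it to the `b`-value, any other row adds nothing. -/
theorem Zadd_VL (ha : ∀ i j, a i j = if (i ∈ BF ∧ j ∈ KF) ∨ (i ∈ KF ∧ j ∈ BF) then 1 else 0)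
    (hV : ∀ M α β, V M α β = fun j : Fin n => if M ≤ (j : ℕ) then (if (j : ℕ) ∈ KF then α else if (j : ℕ) ∈ BF then β else 0) else 0)
    (hdisj : ∀ i, i ∈ BF → i ∉ KF) (M : ℕ) (α β y : ZMod 2) :
    (fun j : Fin n => if M + 1 ≤ (j : ℕ) then V M α β j + a M (j : ℕ) * y else 0) =
      V (M + 1) (α + if M ∈ BF then y else 0) (β + if M ∈ KF then y else 0) := by
  rw [hV, hV]
  funext j
  simp only [ha]
  by_cases h1 : M + 1 ≤ (j : ℕ)
  · rw [if_pos h1, if_pos h1, if_pos (Nat.le_of_succ_le h1)]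
    by_cases hjK : (j : ℕ) ∈ KF
    · have hjB : (j : ℕ) ∉ BF := fun h => hdisj _ h hjK
      simp only [hjK, hjB, and_true, and_false, or_false, if_true]
      split_ifs <;> ring
    · by_cases hjB : (j : ℕ) ∈ BF
      · simp only [hjK, hjB, and_true, and_false, false_or, if_true, if_false]
        split_ifs <;> ring
      · simp [hjK, hjB]
  · rw [if_neg h1, if_neg h1]

/-- Validity (being canonical) is preserved by the label update. -/
theorem IsVL_Zadd (ha : ∀ i j, a i j = if (i ∈ BF ∧ j ∈ KF) ∨ (i ∈ KF ∧ j ∈ BF) then 1 else 0)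
    (hV : ∀ M α β, V M α β = fun j : Fin n => if M ≤ (j : ℕ) then (if (j : ℕ) ∈ KF then α else if (j : ℕ) ∈ BF then β else 0) else 0)
    (hdisj : ∀ i, i ∈ BF → i ∉ KF) (M : ℕ) (π : Fin n → ZMod 2) (y : ZMod 2)
    (h : ∃ α β, π = V M α β) : ∃ α β, (fun j : Fin n => if M + 1 ≤ (j : ℕ) then π j + a M (j : ℕ) * y else 0) = V (M + 1) α β := by
  obtain ⟨α, β, rfl⟩ := h
  exact ⟨_, _, Zadd_VL BF KF a V ha hV hdisj M α β y⟩

/-- SIGN COMPATIBILITY: on canonical labels the step sign of the recursion times the old level sign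
`(-1)^{π(N+1)π(N) + π'(N+1)π'(N)}` is the level sign of the updated labels. -/
theorem sign_compat (ha : ∀ i j, a i j = if (i ∈ BF ∧ j ∈ KF) ∨ (i ∈ KF ∧ j ∈ BF) then 1 else 0)
    (hV : ∀ M α β, V M α β = fun j : Fin n => if M ≤ (j : ℕ) then (if (j : ℕ) ∈ KF then α else if (j : ℕ) ∈ BF then β else 0) else 0)
    (hdisj : ∀ i, i ∈ BF → i ∉ KF) {N M : ℕ} (hMN : M < N) (hn : N + 1 < n) (hB : N ∈ BF) (hK : N + 1 ∈ KF)
    (π π' : Fin n → ZMod 2) (α β α' β' y z c : ZMod 2) (hπ : π = V M α β) (hπ' : π' = V M α' β')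
    (hc : c = 0) :
    (if y * ((if h : M < n then π ⟨M, h⟩ else 0) + c) + z * ((if h : M < n then π' ⟨M, h⟩ else 0) + c) = 1 then (-1 : ℝ) else 1) *
      (if (if h : N + 1 < n then π ⟨N + 1, h⟩ else 0) * (if h : N < n then π ⟨N, h⟩ else 0) + (if h : N + 1 < n then π' ⟨N + 1, h⟩ else 0) * (if h : N < n then π' ⟨N, h⟩ else 0) = 1 then (-1 : ℝ) else 1) =
    (if (if h : N + 1 < n then (fun j : Fin n => if M + 1 ≤ (j : ℕ) then π j + a M (j : ℕ) * y else 0) ⟨N + 1, h⟩ else 0) * (if h : N < n then (fun j : Fin n => if M + 1 ≤ (j : ℕ) then π j + a M (j : ℕ) * y else 0) ⟨N, h⟩ else 0) + (if h : N + 1 < n then (fun j : Fin n => if M + 1 ≤ (j : ℕ) then π' j + a M (j : ℕ) * z else 0) ⟨N + 1, h⟩ else 0) * (if h : N < n then (fun j : Fin n => if M + 1 ≤ (j : ℕ) then π' j + a M (j : ℕ) * z else 0) ⟨N, h⟩ else 0) = 1 then (-1 : ℝ) else 1) := by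
  have hNK : N ∉ KF := fun h => hdisj N hB h
  subst hπ hπ'
  rw [Zadd_VL BF KF a V ha hV hdisj, Zadd_VL BF KF a V ha hV hdisj, ← sign_add]
  rw [ev_VL_K BF KF V hV hn (by omega) hK, ev_VL_K BF KF V hV hn (by omega) hK,
    ev_VL_K BF KF V hV hn (by omega) hK, ev_VL_K BF KF V hV hn (by omega) hK,
    ev_VL_B BF KF V hV (by omega) (by omega) hB hNK, ev_VL_B BF KF V hV (by omega) (by omega) hB hNK,
    ev_VL_B BF KF V hV (by omega) (by omega) hB hNK, ev_VL_B BF KF V hV (by omega) (by omega) hB hNK,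
    ev_VL BF KF V hV (by omega) le_rfl, ev_VL BF KF V hV (by omega) le_rfl, hc]
  congr 1
  by_cases hMB : M ∈ BF
  · have hMK : M ∉ KF := fun h => hdisj M hMB h
    simp only [hMB, hMK, if_true, if_false]
    ring
  · by_cases hMK : M ∈ KF
    · simp only [hMB, hMK, if_true, if_false]
      ring
    · simp only [hMB, hMK, if_false]
      ring

/-- ABSTRACT SIGNED TRANSFER STEP.  If the old family is signed by `σ` and supported on `V`, the step
sign is compatible (`sg · σ = σ' ∘ F` on `V`) and `F` maps `V` into `V'`, then the new family is signed
by `σ'`, supported on `V'`, and its absolute values are the unsigned transfer of the old ones. -/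
theorem step_inv {S J : Type*} [DecidableEq S] (I : Finset S) (Jt : Finset J) (F : S → J → S)
    (sg : S → J → ℝ) (σ σ' : S → ℝ) (V V' : S → Prop) (μ μ' : S → ℝ)
    (hμ' : ∀ s', μ' s' = ∑ s ∈ I, ∑ t ∈ Jt, if F s t = s' then sg s t * μ s else 0)
    (hsg : ∀ s ∈ I, ∀ t ∈ Jt, V s → sg s t * σ s = σ' (F s t))
    (hV : ∀ s ∈ I, ∀ t ∈ Jt, V s → V' (F s t))
    (hσ' : ∀ s, |σ' s| = 1)
    (hinv : ∀ s ∈ I, (¬ V s → μ s = 0) ∧ μ s = σ s * |μ s|) :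
    (∀ s', (¬ V' s' → μ' s' = 0) ∧ μ' s' = σ' s' * |μ' s'|) ∧
    (∀ s', |μ' s'| = ∑ s ∈ I, ∑ t ∈ Jt, if F s t = s' then |μ s| else 0) := by
  have key : ∀ s', μ' s' = σ' s' * ∑ s ∈ I, ∑ t ∈ Jt, if F s t = s' then |μ s| else 0 := by
    intro s'
    rw [hμ', Finset.mul_sum]
    refine Finset.sum_congr rfl fun s hs => ?_
    rw [Finset.mul_sum]
    refine Finset.sum_congr rfl fun t ht => ?_
    split_ifs with h
    · by_cases hVs : V s
      · rw [← h, ← hsg s hs t ht hVs]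
        calc sg s t * μ s = sg s t * (σ s * |μ s|) := by rw [← (hinv s hs).2]
          _ = sg s t * σ s * |μ s| := by ring
      · rw [(hinv s hs).1 hVs, abs_zero, mul_zero, mul_zero]
    · rw [mul_zero]
  have nonneg : ∀ s', 0 ≤ ∑ s ∈ I, ∑ t ∈ Jt, if F s t = s' then |μ s| else 0 := fun s' =>
    Finset.sum_nonneg fun s _ => Finset.sum_nonneg fun t _ => by
      split_ifs
      · exact abs_nonneg _
      · exact le_rfl
  have habs : ∀ s', |μ' s'| = ∑ s ∈ I, ∑ t ∈ Jt, if F s t = s' then |μ s| else 0 := by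
    intro s'
    rw [key, abs_mul, hσ', one_mul, abs_of_nonneg (nonneg s')]
  refine ⟨fun s' => ⟨fun hV' => ?_, ?_⟩, habs⟩
  · rw [hμ']
    refine Finset.sum_eq_zero fun s hs => Finset.sum_eq_zero fun t ht => ?_
    split_ifs with h
    · have : ¬ V s := fun hVs => hV' (h ▸ hV s hs t ht hVs)
      rw [(hinv s hs).1 this, mul_zero]
    · rfl
  · rw [habs]
    exact key s'

/-- UNSIGNED TRANSFER PRESERVES MASS up to the branching factor, provided all targets stay in `I`. -/
theorem step_mass {S J : Type*} [DecidableEq S] (I : Finset S) (Jt : Finset J) (F : S → J → S)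
    (f : S → ℝ) (hF : ∀ s ∈ I, ∀ t ∈ Jt, F s t ∈ I) :
    ∑ s' ∈ I, ∑ s ∈ I, ∑ t ∈ Jt, (if F s t = s' then f s else 0) = Jt.card * ∑ s ∈ I, f s := by
  rw [Finset.sum_comm, Finset.mul_sum]
  refine Finset.sum_congr rfl fun s hs => ?_
  rw [Finset.sum_comm]
  rw [Finset.sum_congr rfl fun t ht => by
    rw [Finset.sum_ite_eq I (F s t) (fun _ => f s), if_pos (hF s hs t ht)]]
  rw [Finset.sum_const, nsmul_eq_mul]

/-- Triple sums as a sum over the product state space. -/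
theorem sum3_eq (A : Finset (ℕ × ℕ)) (f : ℕ × ℕ → (Fin n → ZMod 2) → (Fin n → ZMod 2) → ℝ) :
    ∑ x ∈ A, ∑ π : Fin n → ZMod 2, ∑ π' : Fin n → ZMod 2, f x π π' =
      ∑ s ∈ A ×ˢ (Finset.univ : Finset ((Fin n → ZMod 2) × (Fin n → ZMod 2))), f s.1 s.2.1 s.2.2 := by
  rw [Finset.sum_product]
  refine Finset.sum_congr rfl fun x _ => ?_
  rw [Fintype.sum_prod_type]

/-- The VERBATIM right-hand side of the registered recursion is the abstract signed transfer over the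
state space, with transition `F` (`hF`: carries `(p t + x)/2`, labels `Z_{N'+1}(π + y a_{N'})`) and step
sign `sg` (`hsg`: `(-1)^{y (π(N') + l_{N'}) + z (π'(N') + l_{N'})}`). -/
theorem stepRHS_eq (p q : ℕ) (l : ℕ → ZMod 2) (N' : ℕ)
    (prev : ℕ × ℕ → (Fin n → ZMod 2) → (Fin n → ZMod 2) → ℝ)
    (F : ((ℕ × ℕ) × ((Fin n → ZMod 2) × (Fin n → ZMod 2))) → ℕ → ((ℕ × ℕ) × ((Fin n → ZMod 2) × (Fin n → ZMod 2))))
    (hF : ∀ s t, F s t = (((p * t + s.1.1) / 2, (q * t + s.1.2) / 2), ((fun j : Fin n => if N' + 1 ≤ (j : ℕ) then s.2.1 j + a N' (j : ℕ) * (if (p * t + s.1.1) % 2 = 1 then (1 : ZMod 2) else 0) else 0), (fun j : Fin n => if N' + 1 ≤ (j : ℕ) then s.2.2 j + a N' (j : ℕ) * (if (q * t + s.1.2) % 2 = 1 then (1 : ZMod 2) else 0) else 0))))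
    (sg : ((ℕ × ℕ) × ((Fin n → ZMod 2) × (Fin n → ZMod 2))) → ℕ → ℝ)
    (hsg : ∀ s t, sg s t = (if (if (p * t + s.1.1) % 2 = 1 then (1 : ZMod 2) else 0) * ((if h : N' < n then s.2.1 ⟨N', h⟩ else 0) + l N') + (if (q * t + s.1.2) % 2 = 1 then (1 : ZMod 2) else 0) * ((if h : N' < n then s.2.2 ⟨N', h⟩ else 0) + l N') = 1 then (-1 : ℝ) else 1))
    (x' : ℕ × ℕ) (ρ ρ' : Fin n → ZMod 2) :
    ∑ x ∈ Finset.range p ×ˢ Finset.range q, ∑ π : Fin n → ZMod 2, ∑ π' : Fin n → ZMod 2, ∑ t ∈ Finset.range 2,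
            (if ((p * t + x.1) / 2 = x'.1 ∧ (q * t + x.2) / 2 = x'.2 ∧ (fun j : Fin n => if N' + 1 ≤ (j : ℕ) then π j + a N' (j : ℕ) * (if (p * t + x.1) % 2 = 1 then (1 : ZMod 2) else 0) else 0) = ρ ∧ (fun j : Fin n => if N' + 1 ≤ (j : ℕ) then π' j + a N' (j : ℕ) * (if (q * t + x.2) % 2 = 1 then (1 : ZMod 2) else 0) else 0) = ρ') then (if (if (p * t + x.1) % 2 = 1 then (1 : ZMod 2) else 0) * ((if h : N' < n then π ⟨N', h⟩ else 0) + l N') + (if (q * t + x.2) % 2 = 1 then (1 : ZMod 2) else 0) * ((if h : N' < n then π' ⟨N', h⟩ else 0) + l N') = 1 then (-1 : ℝ) else 1) * prev x π π' else 0) =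
      ∑ s ∈ ((Finset.range p ×ˢ Finset.range q) ×ˢ (Finset.univ : Finset ((Fin n → ZMod 2) × (Fin n → ZMod 2)))), ∑ t ∈ Finset.range 2,
        if F s t = (x', (ρ, ρ')) then sg s t * prev s.1 s.2.1 s.2.2 else 0 := by
  obtain ⟨x1', x2'⟩ := x'
  rw [sum3_eq]
  refine Finset.sum_congr rfl fun s _ => Finset.sum_congr rfl fun t _ => ?_
  rw [hF, hsg]
  refine if_congr ?_ rfl rfl
  simp only [Prod.mk.injEq, and_assoc]

/-- All targets of admissible states are admissible (the carries stay `< p`, `< q`). -/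
theorem trF_mem (p q : ℕ) (N' : ℕ) (F : ((ℕ × ℕ) × ((Fin n → ZMod 2) × (Fin n → ZMod 2))) → ℕ → ((ℕ × ℕ) × ((Fin n → ZMod 2) × (Fin n → ZMod 2))))
    (hF : ∀ s t, F s t = (((p * t + s.1.1) / 2, (q * t + s.1.2) / 2), ((fun j : Fin n => if N' + 1 ≤ (j : ℕ) then s.2.1 j + a N' (j : ℕ) * (if (p * t + s.1.1) % 2 = 1 then (1 : ZMod 2) else 0) else 0), (fun j : Fin n => if N' + 1 ≤ (j : ℕ) then s.2.2 j + a N' (j : ℕ) * (if (q * t + s.1.2) % 2 = 1 then (1 : ZMod 2) else 0) else 0))))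
    (s : ((ℕ × ℕ) × ((Fin n → ZMod 2) × (Fin n → ZMod 2)))) (hs : s ∈ ((Finset.range p ×ˢ Finset.range q) ×ˢ (Finset.univ : Finset ((Fin n → ZMod 2) × (Fin n → ZMod 2)))))
    (t : ℕ) (ht : t ∈ Finset.range 2) : F s t ∈ ((Finset.range p ×ˢ Finset.range q) ×ˢ (Finset.univ : Finset ((Fin n → ZMod 2) × (Fin n → ZMod 2)))) := by
  simp only [Finset.mem_product, Finset.mem_univ, and_true, Finset.mem_range] at hs ⊢
  obtain ⟨h1, h2⟩ := hs
  have ht' : t ≤ 1 := by have := Finset.mem_range.mp ht; omega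
  rw [hF]
  constructor
  · apply Nat.div_lt_of_lt_mul
    nlinarith
  · apply Nat.div_lt_of_lt_mul
    nlinarith

/-- THE INVARIANT of a family obeying the recursion from the point mass, under the interleaved product
pattern with storing columns `N ∈ BF`, `N + 1 ∈ KF` and no linear terms: at every level `M ≤ N` the
family is supported on canonical labels, signed by `(-1)^{π(N+1)π(N) + π'(N+1)π'(N)}`, and has total
mass exactly `2^M` (NO CANCELLATION). -/
theorem inv_mass (ha : ∀ i j, a i j = if (i ∈ BF ∧ j ∈ KF) ∨ (i ∈ KF ∧ j ∈ BF) then 1 else 0)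
    (hV : ∀ M α β, V M α β = fun j : Fin n => if M ≤ (j : ℕ) then (if (j : ℕ) ∈ KF then α else if (j : ℕ) ∈ BF then β else 0) else 0)
    {p q N : ℕ} (hn : N + 1 < n) (hB : N ∈ BF) (hK : N + 1 ∈ KF) (hdisj : ∀ i, i ∈ BF → i ∉ KF)
    (hp : 0 < p) (hq : 0 < q) (l : ℕ → ZMod 2) (hl : ∀ M, l M = 0)
    (μ : ℕ → ℕ × ℕ → (Fin n → ZMod 2) → (Fin n → ZMod 2) → ℝ)
    (hμ0 : ∀ x π π', μ 0 x π π' = if x = (0, 0) ∧ π = 0 ∧ π' = 0 then 1 else 0)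
    (hstep : ∀ N', N' < N → ∀ x' ρ ρ', μ (N' + 1) x' ρ ρ' =
      ∑ x ∈ Finset.range p ×ˢ Finset.range q, ∑ π : Fin n → ZMod 2, ∑ π' : Fin n → ZMod 2, ∑ t ∈ Finset.range 2,
            (if ((p * t + x.1) / 2 = x'.1 ∧ (q * t + x.2) / 2 = x'.2 ∧ (fun j : Fin n => if N' + 1 ≤ (j : ℕ) then π j + a N' (j : ℕ) * (if (p * t + x.1) % 2 = 1 then (1 : ZMod 2) else 0) else 0) = ρ ∧ (fun j : Fin n => if N' + 1 ≤ (j : ℕ) then π' j + a N' (j : ℕ) * (if (q * t + x.2) % 2 = 1 then (1 : ZMod 2) else 0) else 0) = ρ') then (if (if (p * t + x.1) % 2 = 1 then (1 : ZMod 2) else 0) * ((if h : N' < n then π ⟨N', h⟩ else 0) + l N') + (if (q * t + x.2) % 2 = 1 then (1 : ZMod 2) else 0) * ((if h : N' < n then π' ⟨N', h⟩ else 0) + l N') = 1 then (-1 : ℝ) else 1) * μ N' x π π' else 0))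
    (M : ℕ) (hM : M ≤ N) :
    (∀ s' : ((ℕ × ℕ) × ((Fin n → ZMod 2) × (Fin n → ZMod 2))),
      (¬ ((∃ α β, s'.2.1 = V M α β) ∧ (∃ α β, s'.2.2 = V M α β)) → μ M s'.1 s'.2.1 s'.2.2 = 0) ∧
        μ M s'.1 s'.2.1 s'.2.2 =
          (if (if h : N + 1 < n then s'.2.1 ⟨N + 1, h⟩ else 0) * (if h : N < n then s'.2.1 ⟨N, h⟩ else 0) + (if h : N + 1 < n then s'.2.2 ⟨N + 1, h⟩ else 0) * (if h : N < n then s'.2.2 ⟨N, h⟩ else 0) = 1 then (-1 : ℝ) else 1) *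
            |μ M s'.1 s'.2.1 s'.2.2|) ∧
    ∑ s ∈ ((Finset.range p ×ˢ Finset.range q) ×ˢ (Finset.univ : Finset ((Fin n → ZMod 2) × (Fin n → ZMod 2)))), |μ M s.1 s.2.1 s.2.2| = (2 : ℝ) ^ M := by
  induction M with
  | zero =>
    -- the point mass
    have e0 : ∀ s : ((ℕ × ℕ) × ((Fin n → ZMod 2) × (Fin n → ZMod 2))), μ 0 s.1 s.2.1 s.2.2 =
        if s = (((0 : ℕ), (0 : ℕ)), ((0 : Fin n → ZMod 2), (0 : Fin n → ZMod 2))) then 1 else 0 := by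
      intro s
      rw [hμ0]
      refine if_congr ?_ rfl rfl
      obtain ⟨x, π, π'⟩ := s
      simp only [Prod.mk.injEq]
    refine ⟨fun s' => ?_, ?_⟩
    · by_cases hs : s' = (((0 : ℕ), (0 : ℕ)), ((0 : Fin n → ZMod 2), (0 : Fin n → ZMod 2)))
      · rw [e0, if_pos hs]
        refine ⟨fun hV' => absurd ?_ hV', ?_⟩
        · rw [hs]
          exact ⟨⟨0, 0, (VL_zero_zero BF KF V hV 0).symm⟩, ⟨0, 0, (VL_zero_zero BF KF V hV 0).symm⟩⟩
        · rw [hs]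
          simp
      · rw [e0, if_neg hs]
        simp
    · rw [Finset.sum_congr rfl fun s _ => by rw [e0]]
      have hmem : (((0 : ℕ), (0 : ℕ)), ((0 : Fin n → ZMod 2), (0 : Fin n → ZMod 2))) ∈
          ((Finset.range p ×ˢ Finset.range q) ×ˢ (Finset.univ : Finset ((Fin n → ZMod 2) × (Fin n → ZMod 2)))) := by
        simp only [Finset.mem_product, Finset.mem_range, Finset.mem_univ, and_true]
        exact ⟨hp, hq⟩
      rw [Finset.sum_congr rfl fun s _ => by rw [apply_ite abs, abs_one, abs_zero]]
      rw [Finset.sum_ite_eq' _ _ (fun _ => (1 : ℝ)), if_pos hmem, pow_zero]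
  | succ M ih =>
    obtain ⟨ih1, ih2⟩ := ih (by omega)
    have hMN : M < N := by omega
    -- the transition and the step sign of level `M`
    obtain ⟨F, hF⟩ : ∃ F : ((ℕ × ℕ) × ((Fin n → ZMod 2) × (Fin n → ZMod 2))) → ℕ → ((ℕ × ℕ) × ((Fin n → ZMod 2) × (Fin n → ZMod 2))), ∀ s t, F s t =
        (((p * t + s.1.1) / 2, (q * t + s.1.2) / 2),
          ((fun j : Fin n => if M + 1 ≤ (j : ℕ) then s.2.1 j + a M (j : ℕ) * (if (p * t + s.1.1) % 2 = 1 then (1 : ZMod 2) else 0) else 0),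
            (fun j : Fin n => if M + 1 ≤ (j : ℕ) then s.2.2 j + a M (j : ℕ) * (if (q * t + s.1.2) % 2 = 1 then (1 : ZMod 2) else 0) else 0))) := ⟨_, fun _ _ => rfl⟩
    obtain ⟨sg, hsg⟩ : ∃ sg : ((ℕ × ℕ) × ((Fin n → ZMod 2) × (Fin n → ZMod 2))) → ℕ → ℝ, ∀ s t, sg s t =
        (if (if (p * t + s.1.1) % 2 = 1 then (1 : ZMod 2) else 0) * ((if h : M < n then s.2.1 ⟨M, h⟩ else 0) + l M) + (if (q * t + s.1.2) % 2 = 1 then (1 : ZMod 2) else 0) * ((if h : M < n then s.2.2 ⟨M, h⟩ else 0) + l M) = 1 then (-1 : ℝ) else 1) :=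
      ⟨_, fun _ _ => rfl⟩
    have key := step_inv ((Finset.range p ×ˢ Finset.range q) ×ˢ (Finset.univ : Finset ((Fin n → ZMod 2) × (Fin n → ZMod 2)))) (Finset.range 2) F sg
      (fun s => (if (if h : N + 1 < n then s.2.1 ⟨N + 1, h⟩ else 0) * (if h : N < n then s.2.1 ⟨N, h⟩ else 0) + (if h : N + 1 < n then s.2.2 ⟨N + 1, h⟩ else 0) * (if h : N < n then s.2.2 ⟨N, h⟩ else 0) = 1 then (-1 : ℝ) else 1))
      (fun s => (if (if h : N + 1 < n then s.2.1 ⟨N + 1, h⟩ else 0) * (if h : N < n then s.2.1 ⟨N, h⟩ else 0) + (if h : N + 1 < n then s.2.2 ⟨N + 1, h⟩ else 0) * (if h : N < n then s.2.2 ⟨N, h⟩ else 0) = 1 then (-1 : ℝ) else 1))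
      (fun s => (∃ α β, s.2.1 = V M α β) ∧ (∃ α β, s.2.2 = V M α β))
      (fun s => (∃ α β, s.2.1 = V (M + 1) α β) ∧ (∃ α β, s.2.2 = V (M + 1) α β))
      (fun s => μ M s.1 s.2.1 s.2.2)
      (fun s => μ (M + 1) s.1 s.2.1 s.2.2)
      (fun s' => by
        obtain ⟨x', ρ, ρ'⟩ := s'
        rw [hstep M hMN]
        exact stepRHS_eq a p q l M (μ M) F hF sg hsg x' ρ ρ')
      (fun s _ t _ hVs => by
        obtain ⟨⟨α, β, h1⟩, ⟨α', β', h2⟩⟩ := hVs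
        rw [hsg, hF]
        exact sign_compat BF KF a V ha hV hdisj hMN hn hB hK _ _ α β α' β' _ _ (l M) h1 h2 (hl M))
      (fun s _ t _ hVs => by
        rw [hF]
        exact ⟨IsVL_Zadd BF KF a V ha hV hdisj M _ _ hVs.1, IsVL_Zadd BF KF a V ha hV hdisj M _ _ hVs.2⟩)
      (fun s => abs_sign _)
      (fun s _ => ih1 s)
    obtain ⟨k1, k2⟩ := key
    refine ⟨k1, ?_⟩
    rw [Finset.sum_congr rfl fun s' _ => k2 s']
    rw [step_mass _ (Finset.range 2) F _ (fun s hs t ht => trF_mem a p q M F hF s hs t ht), ih2,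
      Finset.card_range, pow_succ]
    push_cast
    ring

/-- NO CANCELLATION (registered helper sub-goal `stub_uwcFalseMass` of `stub_uwcOpCoreFalse`): the `ℓ¹`
mass at level `N` of every family obeying the registered transfer recursion from the point mass, under
the interleaved product pattern with storing columns `N ∈ BF`, `N + 1 ∈ KF` and no linear terms, is
exactly `2^N`. -/
theorem stub_uwcFalseMass : ∀ (n : ℕ) (BF KF : Finset ℕ) (a : ℕ → ℕ → ZMod 2), (∀ i j, a i j = if (i ∈ BF ∧ j ∈ KF) ∨ (i ∈ KF ∧ j ∈ BF) then 1 else 0) → ∀ (p q N : ℕ), N + 1 < n → N ∈ BF → N + 1 ∈ KF → (∀ i, i ∈ BF → i ∉ KF) → 0 < p → 0 < q → ∀ (l : ℕ → ZMod 2), (∀ M, l M = 0) → ∀ (μ : ℕ → ℕ × ℕ → (Fin n → ZMod 2) → (Fin n → ZMod 2) → ℝ), (∀ x π π', μ 0 x π π' = if x = (0, 0) ∧ π = 0 ∧ π' = 0 then 1 else 0) → (∀ N', N' < N → ∀ x' ρ ρ', μ (N' + 1) x' ρ ρ' = ∑ x ∈ Finset.range p ×ˢ Finset.range q, ∑ π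 : Fin n → ZMod 2, ∑ π' : Fin n → ZMod 2, ∑ t ∈ Finset.range 2, (if ((p * t + x.1) / 2 = x'.1 ∧ (q * t + x.2) / 2 = x'.2 ∧ (fun j : Fin n => if N' + 1 ≤ (j : ℕ) then π j + a N' (j : ℕ) * (if (p * t + x.1) % 2 = 1 then (1 : ZMod 2) else 0) else 0) = ρ ∧ (fun j : Fin n => if N' + 1 ≤ (j : ℕ) then π' j + a N' (j : ℕ) * (if (q * t + x.2) % 2 = 1 then (1 : ZMod 2) else 0) else 0) = ρ') then (if (if (p * t + x.1) % 2 = 1 then (1 : ZMod 2) else 0) * ((if h : N' < n then π ⟨N', h⟩ else 0) + l N') + (if (q * t + x.2) % 2 = 1 then (1 : ZMod 2) else 0) * ((if h : N' < n then π' ⟨N', h⟩ else 0) + l N') = 1 then (-1 : ℝ) else 1) * μ N' x π π' else 0)) → ∑ x ∈ Finset.range p ×ˢ Finset.range q, ∑ π : Fin n → ZMod 2, ∑ π' : Fin n → ZMod 2, |μ N x π π'| = (2 : ℝ) ^ N := by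
  intro n BF KF a ha p q N hn hB hK hdisj hp hq l hl μ hμ0 hstep
  obtain ⟨V, hV⟩ : ∃ V : ℕ → ZMod 2 → ZMod 2 → (Fin n → ZMod 2), ∀ M α β, V M α β =
      fun j : Fin n => if M ≤ (j : ℕ) then (if (j : ℕ) ∈ KF then α else if (j : ℕ) ∈ BF then β else 0) else 0 := ⟨_, fun _ _ _ => rfl⟩
  rw [sum3_eq]
  exact (inv_mass BF KF a V ha hV hn hB hK hdisj hp hq l hl μ hμ0 hstep N le_rfl).2

end Summit.QuantumAdvantage.QuantumAdvantage.Theorems.MobiusLadderQuadraticDigitPhasesStubUwcOpCoreFalseLemmas
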